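import Mathlib.Analysis.Matrix.Spectrum
import Mathlib.Analysis.InnerProductSpace.Projection.FiniteDimensional
import Mathlib.Topology.Compactness.Compact
import Literature.Analysis.FluidPDE.StationaryEulerLaminates
import HarnessLib

/-!
# The relaxed set `int 𝒦_r^{co}` in dimension `d ≥ 3` (Choffrut–Székelyhidi 2014, §4)

Topic `Literature/Analysis/FluidPDE`. Support file of the proof of
`Literature.Analysis.FluidPDE.Torus.ChoffrutSzekelyhidi2014_thm1` (Choffrut–Székelyhidi, SIAM
J. Math. Anal. 46 (2014) = arXiv:1401.4301). In dimension `d ≥ 3` the paper takes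
`𝒰_r := int 𝒦_r^{co}` (Cor. 12), where by (2.5) `𝒦_r^{co} = {(v, u) : v ⊗ v - u ≤ (r/d) Id}`;
accordingly we put `U r := {w admissible : u - v ⊗ v + (r/d) Id ≻ 0}` (positive definite gap
matrix) and prove the elementary half of what the interface `RelaxedFamily` asks for:

* `U r ⊆ C r`, `U r` is convex and relatively open jointly in `(r, w)` (compactness of the unit
  sphere), and property (*) `𝒦_{r'} ⊆ 𝒰_r` for `0 ≤ r' < r` ("follows easily from the explicit
  formula (2.5)", proof of Cor. 12);
* the linear algebra used by the explicit laminates of `StationaryEulerLaminatesHighDim.lean`: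
  the spectral decomposition `N = Σᵢ μᵢ fᵢ ⊗ fᵢ` of the (symmetric, positive definite) gap
  matrix, and — the only place where `d ≥ 3` enters, exactly as in Lemma 11 of the paper — the
  existence of a non-zero vector orthogonal to two given vectors.

## References

* A. Choffrut, L. Székelyhidi Jr., *Weak solutions to the stationary incompressible Euler
  equations*, SIAM J. Math. Anal. 46 (2014), §2 (2.5), §4 (Lemma 11, Cor. 12).
* C. De Lellis, L. Székelyhidi Jr., Arch. Ration. Mech. Anal. 195 (2010), Lemma 3, §4.3.
-/

noncomputable section

open scoped InnerProductSpace Matrix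
open Filter Topology

namespace Literature.Analysis.FluidPDE

namespace StationaryEuler

variable {d : Type*} [Fintype d] [DecidableEq d]

/-! ## The relaxed set `int 𝒦_r^{co}` -/

namespace HighDim

/-- The relaxed set of §4: admissible states with positive definite gap matrix,
`𝒰_r = int 𝒦_r^{co} = {(v, u) ∈ ℝ^d × 𝒮^d_0 : v ⊗ v - u < (r/d) Id}`.
[cite: ChoffrutSzekelyhidi2014, Cor. 12] -/
def U (r : ℝ) : Set (State d) :=
  {w | IsAdm w ∧ ∀ x : d → ℝ, x ≠ 0 → 0 < x ⬝ᵥ (gap r w *ᵥ x)}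

/-- Membership in `𝒰_r`. [folklore] -/
theorem mem_U_iff {r : ℝ} {w : State d} :
    w ∈ U r ↔ IsAdm w ∧ ∀ x : d → ℝ, x ≠ 0 → 0 < x ⬝ᵥ (gap r w *ᵥ x) := Iff.rfl

/-- `𝒰_r ⊆ 𝒦_r^{co}`. [cite: ChoffrutSzekelyhidi2014, Cor. 12] -/
theorem U_subset_C (r : ℝ) : U r ⊆ (C r : Set (State d)) := by
  intro w hw
  refine mem_C_iff.2 ⟨hw.1, fun x => ?_⟩
  rcases eq_or_ne x 0 with rfl | hx
  · simp
  · exact (hw.2 x hx).le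

/-- The gap matrix of a point of `𝒰_r` is positive definite. [folklore] -/
theorem posDef_gap {r : ℝ} {w : State d} (hw : w ∈ U r) : (gap r w).PosDef :=
  Matrix.PosDef.of_dotProduct_mulVec_pos (Matrix.isHermitian_iff_isSymm.2 (gap_isSymm hw.1.1))
    fun x hx => by simpa using hw.2 x hx

/-- `𝒰_r` is convex. [folklore] -/
theorem convex_U (r : ℝ) : Convex ℝ (U r : Set (State d)) := by
  intro w₁ h₁ w₂ h₂ a b ha hb hab
  refine ⟨(h₁.1.smul a).add (h₂.1.smul b), fun x hx => ?_⟩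
  have := convexCombo_dotProduct_gap_mulVec_le r w₁ w₂ ha hb hab x
  have q₁ := h₁.2 x hx
  have q₂ := h₂.2 x hx
  rcases ha.lt_or_eq with ha' | rfl
  · nlinarith [mul_pos ha' q₁, mul_nonneg hb q₂.le]
  · simp only [zero_add] at hab
    subst hab
    nlinarith

/-- **Property (*)** (proof of Cor. 12): `𝒦_{r'} ⊆ 𝒰_r` for `0 ≤ r' < r` — on `𝒦_{r'}` the gap
matrix for the parameter `r` is `((r - r')/d) Id ≻ 0`. [cite: ChoffrutSzekelyhidi2014, Cor. 12] -/
theorem K_subset_U [Nonempty d] {r r' : ℝ} (hr' : 0 ≤ r') (h : r' < r) :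
    K r' ⊆ (U r : Set (State d)) := by
  intro w hw
  refine ⟨isAdm_of_mem_K hw, fun x hx => ?_⟩
  rw [dotProduct_gap_mulVec_eq_add r r', gap_eq_zero_of_mem_K hw, Matrix.zero_mulVec,
    dotProduct_zero, zero_add]
  have hpos : 0 < ∑ i, x i ^ 2 := by
    obtain ⟨i, hi⟩ := Function.ne_iff.1 hx
    have hi' : 0 < x i ^ 2 := sq_pos_iff.2 (by simpa using hi)
    exact lt_of_lt_of_le hi' (Finset.single_le_sum (fun j _ => sq_nonneg (x j))
      (Finset.mem_univ i))
  have hc : (0 : ℝ) < Fintype.card d := by exact_mod_cast Fintype.card_pos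
  have _ := hr'
  exact mul_pos (div_pos (by linarith) hc) hpos

/-- Each `𝒰_r` is non-empty only for `r > 0`: `r - |v|² = tr N > 0`. [folklore] -/
theorem pos_of_mem_U [Nonempty d] {r : ℝ} {w : State d} (hw : w ∈ U r) : ‖vel w‖ ^ 2 < r := by
  have h := (posDef_gap hw).trace_pos
  rw [trace_gap hw.1] at h
  linarith

/-! ### Joint openness -/

/-- The gap form is jointly continuous in `(r, w, x)`. [folklore] -/
theorem continuous_gapForm :
    Continuous fun p : (ℝ × State d) × (d → ℝ) => p.2 ⬝ᵥ (gap p.1.1 p.1.2 *ᵥ p.2) := by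
  simp only [dotProduct_mulVec_eq_sum]
  refine continuous_finsetSum _ fun i _ => continuous_finsetSum _ fun j _ => ?_
  exact (((continuous_apply i).comp continuous_snd).mul
    ((continuous_gap_apply i j).comp continuous_fst)).mul ((continuous_apply j).comp continuous_snd)

omit [DecidableEq d] in
/-- Positive definiteness only needs to be tested on the unit sphere of the sup norm. [folklore] -/
theorem forall_pos_iff_sphere (M : Matrix d d ℝ) :
    (∀ x : d → ℝ, x ≠ 0 → 0 < x ⬝ᵥ (M *ᵥ x)) ↔ ∀ x : d → ℝ, ‖x‖ = 1 → 0 < x ⬝ᵥ (M *ᵥ x) := by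
  constructor
  · intro h x hx
    exact h x (by rintro rfl; simp at hx)
  · intro h x hx
    have hn : ‖x‖ ≠ 0 := norm_ne_zero_iff.2 hx
    have h1 := h (‖x‖⁻¹ • x) (by rw [norm_smul, norm_inv, norm_norm, inv_mul_cancel₀ hn])
    rw [Matrix.mulVec_smul, dotProduct_smul, smul_dotProduct, smul_eq_mul, smul_eq_mul,
      ← mul_assoc] at h1
    have hpos : 0 < ‖x‖⁻¹ * ‖x‖⁻¹ := by positivity
    exact pos_of_mul_pos_right (by linarith) hpos.le |> fun h => by nlinarith [h1, hpos]

/-- **Joint relative openness of `{(r, w) : w ∈ 𝒰_r}`**: positive definiteness is an open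
condition in `(r, w)` (compactness of the unit sphere). [folklore] -/
theorem relOpen (r : ℝ) (w : State d) (hw : w ∈ U r) :
    ∃ ε > 0, ∀ r' w', |r' - r| < ε → IsAdm w' → dist w' w < ε → w' ∈ U r' := by
  have hK : IsCompact (Metric.sphere (0 : d → ℝ) 1) := isCompact_sphere _ _
  have hev : ∀ᶠ p : ℝ × State d in 𝓝 (r, w), ∀ x ∈ Metric.sphere (0 : d → ℝ) 1,
      0 < x ⬝ᵥ (gap p.1 p.2 *ᵥ x) := by
    refine hK.eventually_forall_of_forall_eventually fun x hx => ?_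
    have hx1 : ‖x‖ = 1 := by simpa using hx
    have h0 : 0 < x ⬝ᵥ (gap r w *ᵥ x) := (forall_pos_iff_sphere _).1 hw.2 x hx1
    exact (continuous_gapForm.continuousAt (x := ((r, w), x))).eventually (eventually_gt_nhds h0)
  obtain ⟨ε, hε, hball⟩ := Metric.eventually_nhds_iff.1 hev
  refine ⟨ε, hε, fun r' w' hr hw' hd => ⟨hw', (forall_pos_iff_sphere _).2 fun x hx => ?_⟩⟩
  have hdist : dist (r', w') (r, w) < ε := by
    rw [Prod.dist_eq]; exact max_lt (by rwa [Real.dist_eq]) hd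
  exact hball hdist x (by simpa using hx)

/-- For `w ∈ 𝒰_r` also `w ∈ 𝒰_{r'}` for all `r'` close to `r`. [folklore] -/
theorem exists_mem_U_of_lt {r : ℝ} {w : State d} (hw : w ∈ U r) {ε : ℝ} (hε : 0 < ε) (hr : 0 < r) :
    ∃ r', r - ε < r' ∧ r' < r ∧ 0 < r' ∧ w ∈ U r' := by
  obtain ⟨ε₁, hε₁, h⟩ := relOpen r w hw
  set δ := min (min ε ε₁) r with hδ
  have hδpos : 0 < δ := lt_min (lt_min hε hε₁) hr
  refine ⟨r - δ / 2, by linarith [min_le_left (min ε ε₁) r, min_le_left ε ε₁], by linarith,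
    by linarith [min_le_right (min ε ε₁) r], h _ _ ?_ hw.1 (by simp [hε₁])⟩
  rw [show r - δ / 2 - r = -(δ / 2) by ring, abs_neg, abs_of_pos (by linarith)]
  linarith [min_le_left (min ε ε₁) r, min_le_right ε ε₁]

/-! ## Linear algebra for the explicit laminates -/

omit [DecidableEq d] in
/-- The quadratic form of a rank-one matrix `f ⊗ f` is a square: `xᵀ (f ⊗ f) x = (f · x)²`. [folklore] -/
theorem dotProduct_vecMulVec_mulVec (f x : d → ℝ) :
    x ⬝ᵥ (Matrix.vecMulVec f f *ᵥ x) = (f ⬝ᵥ x) ^ 2 := by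
  rw [Matrix.vecMulVec_mulVec, op_smul_eq_smul, dotProduct_smul, smul_eq_mul, dotProduct_comm x f,
    sq]

omit [DecidableEq d] in
/-- A rank-one projector applied to a vector: `(f ⊗ f) y = (f · y) f`. [folklore] -/
theorem vecMulVec_mulVec_eq_smul (f y : d → ℝ) :
    Matrix.vecMulVec f f *ᵥ y = (f ⬝ᵥ y) • f := by
  rw [Matrix.vecMulVec_mulVec, op_smul_eq_smul]

omit [DecidableEq d] in
/-- The real inner product on `EuclideanSpace ℝ d` is the dot product of the coordinates. [folklore] -/
theorem inner_eq_dotProduct (x y : EuclideanSpace ℝ d) : ⟪x, y⟫_ℝ = (⇑x) ⬝ᵥ (⇑y) := by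
  rw [EuclideanSpace.inner_eq_star_dotProduct, star_trivial, dotProduct_comm]

/-- **Spectral decomposition of a real symmetric matrix as a sum of rank-one matrices**:
`N = Σᵢ μᵢ fᵢ ⊗ fᵢ` for the orthonormal eigenbasis `(fᵢ)` and eigenvalues `(μᵢ)` of `N`. [folklore] -/
theorem eq_sum_eigenvalues_smul_vecMulVec {N : Matrix d d ℝ} (hN : N.IsHermitian) :
    N = ∑ i, hN.eigenvalues i •
      Matrix.vecMulVec (⇑(hN.eigenvectorBasis i)) (⇑(hN.eigenvectorBasis i)) := by
  set f := hN.eigenvectorBasis with hf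
  have hmul : ∀ y : EuclideanSpace ℝ d, N *ᵥ ⇑y =
      (∑ i, hN.eigenvalues i • Matrix.vecMulVec (⇑(f i)) (⇑(f i))) *ᵥ ⇑y := by
    intro y
    have hy : (⇑y : d → ℝ) = ∑ i, ⟪f i, y⟫_ℝ • ⇑(f i) := by
      conv_lhs => rw [← f.sum_repr' y]
      rw [WithLp.ofLp_sum]; rfl
    conv_lhs => rw [hy]
    rw [Matrix.mulVec_sum, Matrix.sum_mulVec]
    refine Finset.sum_congr rfl fun i _ => ?_
    rw [Matrix.mulVec_smul, hN.mulVec_eigenvectorBasis i, Matrix.smul_mulVec,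
      vecMulVec_mulVec_eq_smul, ← inner_eq_dotProduct, smul_smul, smul_smul, mul_comm]
  ext j k
  have h := congrFun (hmul (EuclideanSpace.single k 1)) j
  have hs : (⇑(EuclideanSpace.single k (1 : ℝ)) : d → ℝ) = Pi.single k 1 := by
    ext i; simp [Pi.single_apply]
  rw [hs, Matrix.mulVec_single_one, Matrix.mulVec_single_one] at h
  exact h

/-- In the eigenbasis the gap matrix acts diagonally:
`N fⱼ = μⱼ fⱼ` (restated with the dot-product form of `Σᵢ μᵢ fᵢ ⊗ fᵢ`). [folklore] -/
theorem sum_smul_vecMulVec_mulVec_basis {f : OrthonormalBasis d ℝ (EuclideanSpace ℝ d)}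
    (c : d → ℝ) (j : d) :
    (∑ i, c i • Matrix.vecMulVec (⇑(f i)) (⇑(f i))) *ᵥ ⇑(f j) = c j • ⇑(f j) := by
  rw [Matrix.sum_mulVec]
  have h : ∀ i, (c i • Matrix.vecMulVec (⇑(f i)) (⇑(f i))) *ᵥ ⇑(f j) =
      if i = j then c j • ⇑(f j) else 0 := by
    intro i
    rw [Matrix.smul_mulVec, vecMulVec_mulVec_eq_smul, ← inner_eq_dotProduct]
    have := orthonormal_iff_ite.1 f.orthonormal i j
    rw [this]
    split_ifs with hij
    · subst hij; simp
    · simp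
  simp_rw [h]
  simp

omit [DecidableEq d] in
/-- **The only use of `d ≥ 3`** (Lemma 11 of the paper): given two vectors of `ℝ^d`, `d ≥ 3`,
there is a non-zero vector orthogonal to both. [cite: ChoffrutSzekelyhidi2014, Lemma 11] -/
theorem exists_ne_zero_inner_eq_zero_of_three_le (hd : 3 ≤ Fintype.card d)
    (a b : EuclideanSpace ℝ d) : ∃ η : EuclideanSpace ℝ d, η ≠ 0 ∧ ⟪a, η⟫_ℝ = 0 ∧ ⟪b, η⟫_ℝ = 0 := by
  set K : Submodule ℝ (EuclideanSpace ℝ d) := Submodule.span ℝ (({a, b} : Finset _) : Set _) with hK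
  have hKle : Module.finrank ℝ K ≤ 2 := by
    refine (finrank_span_finset_le_card ({a, b} : Finset (EuclideanSpace ℝ d))).trans ?_
    exact (Finset.card_insert_le _ _).trans (by simp)
  have hsum := Submodule.finrank_add_finrank_orthogonal K
  rw [finrank_euclideanSpace] at hsum
  have hpos : 0 < Module.finrank ℝ Kᗮ := by omega
  have hne : Kᗮ ≠ ⊥ := fun h => by rw [h, finrank_bot] at hpos; exact lt_irrefl _ hpos
  obtain ⟨η, hηK, hη⟩ := Submodule.exists_mem_ne_zero_of_ne_bot hne
  rw [Submodule.mem_orthogonal] at hηK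
  have ha : a ∈ K := Submodule.subset_span (by simp)
  have hb : b ∈ K := Submodule.subset_span (by simp)
  exact ⟨η, hη, hηK a ha, hηK b hb⟩

end HighDim

end StationaryEuler

end Literature.Analysis.FluidPDE
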